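import Literature.NumberTheory.EllipticCurves.HidaFamilyMembers
import HarnessLib

/-!
# BirchSwinnertonDyer / TangentCone — crux `EdgeCap` (stmt-BirchSwinnertonDyer-17609), line
# `ratio_measure_strassmann`, stub M `stub_membersExist`: reduction to the Hida named fact

Stub M of the registered skeleton v5 of line `ratio_measure_strassmann`
(`Cruxes/EdgeCap/Lines/ratio_measure_strassmann.lean`, `EdgeCap_of : M → A1 → A2 → D → T → EdgeCap`)
asks, for a globally minimal `W` (elliptic, conductor `N = W.conductorNorm ℤ`), a prime `p ≥ 5` of
good ordinary reduction and every `b > 0`, `t > 0`, for an ordinary newform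
`g ∈ S_k(Γ₀(N))`, `k = 2 + 2b(p−1)t`, with a `p`-adic embedding `ι : K_g →+* ℚ̄_p` of its
coefficient field such that `|ι a_p(g)|_p = 1` and `|ι a_ℓ(g) − a_ℓ(E)|_p < 1` for every prime
`ℓ ∤ N p` — the weight-`k` member of the Hida branch through `f_E` (Hida 1986;
Emerton–Pollack–Weston 2005, Thms. 2.1.2, 2.2.2; Hida, *Elementary Modular Iwasawa Theory*,
Thm. 4.1.29, Cor. 4.1.30; plus modularity).

This is VERBATIM the specialisation of the tree named fact
`Literature.NumberTheory.EllipticCurves.hida_exists_congruent_ordinary_newform`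
(`Literature/NumberTheory/EllipticCurves/HidaFamilyMembers.lean`; a `def … : Prop`, not yet
discharged in the tree — it needs Hida theory and modularity) at the progression weights
`k = 2 + 2b(p−1)t`, for which `2 < k` and `(p − 1) ∣ (k − 2) = 2bt(p − 1)`.

This file records that reduction, kernel-checked: `stub_membersExist_of_hida` derives the
registered statement of stub M from the hypothesis
`(h : hida_exists_congruent_ordinary_newform)`. It is CONDITIONAL on that one named fact, introduces
no definition and no new named fact, and SUPPORTS stmt-BirchSwinnertonDyer-17609 (it does not close
it, and it does not land the stub under its registered name).
-/

-- D-0017: single-problem summit, so `Summit.BirchSwinnertonDyer.BirchSwinnertonDyer.…` repeats a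
-- namespace BY DESIGN.
set_option linter.dupNamespace false

noncomputable section

namespace Summit.BirchSwinnertonDyer.BirchSwinnertonDyer.Theorems

open scoped MatrixGroups ModularForm

/-- **Stub M (`stub_membersExist`) of line `ratio_measure_strassmann` for crux `TangentCone.EdgeCap`
(stmt-BirchSwinnertonDyer-17609), from the Hida named fact.** Assume
`Literature.NumberTheory.EllipticCurves.hida_exists_congruent_ordinary_newform` (classical members
of the Hida family through an ordinary elliptic curve: Hida 1986; Emerton–Pollack–Weston 2005,
Thms. 2.1.2 and 2.2.2; Hida EMI Thm. 4.1.29, Cor. 4.1.30; modularity). Then for every globally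
minimal Weierstrass equation `W` of an elliptic curve over `ℚ` with `N = W.conductorNorm ℤ ≠ 0`,
every prime `p ≥ 5` of good ordinary reduction (`p ∤ a_p(E)`), every `b > 0` and every `t > 0`
there are a newform `g ∈ S_k(Γ₀(N))` of weight `k = 2 + 2b(p−1)t` and a ring embedding
`ι : K_g →+* ℚ̄_p` with `|ι a_p(g)|_p = 1` and `|ι a_ℓ(g) − a_ℓ(E)|_p < 1` for all primes
`ℓ ∤ N p`. Proof: apply the fact at `k = 2 + 2b(p−1)t`, where `2 < k` (as `2b(p−1)t ≥ 1`) and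
`k − 2 = (2bt)·(p − 1)`. [cite: Hida1986] [cite: EmertonPollackWeston2005, Thm. 2.1.2 and Thm. 2.2.2]
[cite: Hida2022EMI, Thm. 4.1.29 and Cor. 4.1.30] -/
theorem stub_membersExist_of_hida
    (h : Literature.NumberTheory.EllipticCurves.hida_exists_congruent_ordinary_newform) :
    ∀ (W : WeierstrassCurve ℚ) [W.IsElliptic] [W.IsGloballyMinimal] (_ : NeZero (W.conductorNorm ℤ)) (p : ℕ) [Fact p.Prime], 5 ≤ p → W.HasGoodReductionAtPrime p → ¬ (p : ℤ) ∣ W.frobeniusTrace p → ∀ (b : ℕ), 0 < b → (∀ t : ℕ, 0 < t → ∃ (g : CuspForm (CongruenceSubgroup.Gamma0 (W.conductorNorm ℤ)) ((2 + 2 * b * (p - 1) * t : ℕ) : ℤ)) (ι : Literature.NumberTheory.EllipticCurves.ModularForms.coeffField g →+* PadicAlgCl p), Literature.NumberTheory.EllipticCurves.ModularForms.IsNewform0 g ∧ ‖ι ⟨(UpperHalfPlane.qExpansion 1 ⇑g).coeff p, Literature.NumberTheory.EllipticCurves.ModularForms.coeff_mem_coeffField g p⟩‖ = 1 ∧ (∀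 ℓ : ℕ, ℓ.Prime → ¬ ℓ ∣ W.conductorNorm ℤ * p → ‖ι ⟨(UpperHalfPlane.qExpansion 1 ⇑g).coeff ℓ, Literature.NumberTheory.EllipticCurves.ModularForms.coeff_mem_coeffField g ℓ⟩ - ((W.frobeniusTrace ℓ : ℤ) : PadicAlgCl p)‖ < 1)) := by
  intro W _ _ hN p _ hp hgood hord b hb t ht
  -- `1 ≤ p`, to push the cast through the natural-number subtraction `p - 1`
  have hp1 : 1 ≤ p := le_trans (by norm_num) hp
  -- the increment `2b(p−1)t` of the weight is positive
  have hpos : 0 < 2 * b * (p - 1) * t :=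
    Nat.mul_pos (Nat.mul_pos (Nat.mul_pos (by norm_num) hb) (by omega)) ht
  refine h W hN p hp hgood hord (((2 + 2 * b * (p - 1) * t : ℕ) : ℤ)) ?_ ?_
  · -- `2 < k`
    exact_mod_cast Nat.lt_add_of_pos_right hpos
  · -- `(p − 1) ∣ (k − 2) = 2bt · (p − 1)`
    refine ⟨2 * (b : ℤ) * t, ?_⟩
    push_cast [Nat.cast_sub hp1]
    ring

/-- **Registered form (`stub_membersExist_of_hidaFact`, verbatim signature) of `stub_membersExist_of_hida`:** the Hida named
fact implies the statement of stub M of line `ratio_measure_strassmann` (crux `EdgeCap`, stmt-BirchSwinnertonDyer-17609). -/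
theorem stub_membersExist_of_hidaFact :
    Literature.NumberTheory.EllipticCurves.hida_exists_congruent_ordinary_newform → (∀ (W : WeierstrassCurve ℚ) [W.IsElliptic] [W.IsGloballyMinimal] (_ : NeZero (W.conductorNorm ℤ)) (p : ℕ) [Fact p.Prime], 5 ≤ p → W.HasGoodReductionAtPrime p → ¬ (p : ℤ) ∣ W.frobeniusTrace p → ∀ (b : ℕ), 0 < b → (∀ t : ℕ, 0 < t → ∃ (g : CuspForm (CongruenceSubgroup.Gamma0 (W.conductorNorm ℤ)) ((2 + 2 * b * (p - 1) * t : ℕ) : ℤ)) (ι : Literature.NumberTheory.EllipticCurves.ModularForms.coeffField g →+* PadicAlgCl p), Literature.NumberTheory.EllipticCurves.ModularForms.IsNewform0 g ∧ ‖ι ⟨(UpperHalfPlane.qExpansion 1 ⇑g).coeff p, Literature.NumberTheory.EllipticCurves.ModularForms.coeff_mem_coeffField g p⟩‖ = 1 ∧ (∀ ℓ : ℕ, ℓ.Prime → ¬ ℓ ∣ W.conductorNorm ℤ * p → ‖ι ⟨(UpperHalfPlane.qExpansion 1 ⇑g).coeff ℓ, Literature.NumberTheory.EllipticCurves.ModularForms.coeff_mem_coeffField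 g ℓ⟩ - ((W.frobeniusTrace ℓ : ℤ) : PadicAlgCl p)‖ < 1))) :=
  fun h => stub_membersExist_of_hida h

end Summit.BirchSwinnertonDyer.BirchSwinnertonDyer.Theorems

end
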